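import Mathlib
import HarnessLib
import Literature.Computability.AlgebraicComplexity.HessianRank

/-!
# Crux `RankDefectRepresentations` (stmt-PneNP-18923), line `rank-dehn-ladder`, stub `stub_cutLemma`: ONE-SIDED (MONOTONE) CUTS ARE ADDITIVE

Setting of the registered negative rung `stub_cutLemma`: rows `x : ι` and columns `y : ι'` carry cube colours
`row x, col y : Fin n → Bool`; the `j`-th coordinate cut of `R` is `R ∘ 1[row_j ≠ col_j]`, of rank `t_j`; the cut lemma asks
for a colour-diagonal `R'` (supported on `row = col`) with `rank (R − R') ≤ C (n+1)^a · t`.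

This file proves the cut lemma with the SHARP ADDITIVE constant for ONE-SIDED ("monotone") matrices: if `R` vanishes on every
colour pair with `row_j = true, col_j = false` for some `j` — i.e. `R` is supported on pairs with `row ≤ col` componentwise, all
"down" halves of the coordinate cuts are empty — then

  `∃ R' colour-diagonal, rank (R − R') ≤ ∑_j t_j`        (`cutLemma_monotone`).

Proof (lead g5, `Lines/rank-dehn-ladder-briefs.md` §g5): split rows and columns by the colour bit `0`. The block of `R` with
row bit `true` and column bit `false` vanishes, the block with row bit `false` and column bit `true` IS the `0`-th cut, and the two
diagonal blocks are one-sided instances on the remaining `n` coordinates. The key point is that for a block upper-triangular matrix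
`rank A + rank D ≤ rank [[A, B], [0, D]]` (`rank_add_rank_le_rank_fromBlocks_triu`), applied to every cut `j+1` of `R`: the cut
ranks of the two diagonal blocks ADD UP to at most the cut rank of `R` (`rank_blocks_le_of_lowerLeft_zero`) — no doubling, hence
no `2^n`. Consequence for the line: a violator of the additive cut inequality `dist ≤ ∑_j t_j` must be two-sided in every
coordinate at every scale of the recursion; in the `Ext¹` (two-step extension) mechanism of `Lines/dead-RDR-analysis-v2.md` this
says cocycles supported on comparable pairs `σ ≤ τ` of the cube never amplify.
HONEST FRAMING: a tool lemma on the Negative/ lane of the crux; P ≠ NP is not moved; F-N2 is a FRONTIER formal rung.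
-/

set_option linter.dupNamespace false -- `Summit.PneNP.PneNP.…`: summit = sub-problem name (D-0017)

namespace Summit.PneNP.PneNP.Theorems.CnfIdealGenLengthRankDefectRepresentationsCutLemmaMonotoneCuts

open Finset Matrix
open Literature.Computability.AlgebraicComplexity (rank_add_le)

variable {K : Type*} [Field K]

section Blocks

variable {p q p' q' : Type*} [Fintype p] [Fintype q] [Fintype p'] [Fintype q']
  [DecidableEq p] [DecidableEq q] [DecidableEq p'] [DecidableEq q']

omit [Fintype p] [Fintype q] [DecidableEq p] [DecidableEq q] [DecidableEq p'] [DecidableEq q'] in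
/-- **Block upper-triangular matrices: the diagonal blocks' ranks add up below the total rank**,
`rank A + rank D ≤ rank [[A, B], [0, D]]`. (Project the column space onto the second summand: the image contains the column
space of `D`, the kernel contains a copy of the column space of `A`.) [folklore] -/
theorem rank_add_rank_le_rank_fromBlocks_triu (A : Matrix p p' K) (B : Matrix p q' K) (D : Matrix q q' K) :
    A.rank + D.rank ≤ (Matrix.fromBlocks A B 0 D).rank := by
  classical
  set M := Matrix.fromBlocks A B (0 : Matrix q p' K) D with hM
  let Rg : Submodule K (p ⊕ q → K) := LinearMap.range M.mulVecLin
  -- restriction to the `q`-coordinates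
  let π : (p ⊕ q → K) →ₗ[K] (q → K) := LinearMap.funLeft K K Sum.inr
  let φ : Rg →ₗ[K] (q → K) := π.comp Rg.subtype
  have key := LinearMap.finrank_range_add_finrank_ker φ
  -- (1) the range of `φ` contains the column space of `D`
  have h1 : LinearMap.range D.mulVecLin ≤ LinearMap.range φ := by
    rintro _ ⟨y, rfl⟩
    refine ⟨⟨M *ᵥ Sum.elim 0 y, ⟨Sum.elim 0 y, rfl⟩⟩, ?_⟩
    ext i
    simp [φ, π, hM, Matrix.fromBlocks_mulVec, LinearMap.funLeft_apply]
  -- (2) the kernel of `φ` contains a copy of the column space of `A`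
  let emb : (p → K) →ₗ[K] (p ⊕ q → K) :=
    { toFun := fun v => Sum.elim v 0
      map_add' := fun v w => by funext s; cases s <;> simp
      map_smul' := fun c v => by funext s; cases s <;> simp }
  have hemb : Function.Injective emb := by
    intro v w h
    funext i
    have := congrFun h (Sum.inl i)
    simpa [emb] using this
  have h2 : (LinearMap.range A.mulVecLin).map emb ≤ (LinearMap.ker φ).map Rg.subtype := by
    rintro _ ⟨_, ⟨x, rfl⟩, rfl⟩
    have hmem : emb (A *ᵥ x) ∈ Rg := by
      refine ⟨Sum.elim x 0, ?_⟩
      show M *ᵥ Sum.elim x 0 = Sum.elim (A *ᵥ x) 0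
      rw [hM, Matrix.fromBlocks_mulVec]
      simp
    refine ⟨⟨emb (A *ᵥ x), hmem⟩, ?_, rfl⟩
    simp only [SetLike.mem_coe, LinearMap.mem_ker]
    ext i
    simp [φ, π, emb, LinearMap.funLeft_apply]
  have hA : A.rank ≤ Module.finrank K (LinearMap.ker φ) := by
    have e1 : Module.finrank K ((LinearMap.range A.mulVecLin).map emb) = A.rank := by
      unfold Matrix.rank
      exact (LinearEquiv.finrank_eq (Submodule.equivMapOfInjective emb hemb _)).symm
    have e2 : Module.finrank K ((LinearMap.ker φ).map Rg.subtype) = Module.finrank K (LinearMap.ker φ) :=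
      (LinearEquiv.finrank_eq (Submodule.equivMapOfInjective Rg.subtype Rg.injective_subtype _)).symm
    have := Submodule.finrank_mono h2
    omega
  have hD : D.rank ≤ Module.finrank K (LinearMap.range φ) := by
    unfold Matrix.rank
    exact Submodule.finrank_mono h1
  have hMr : M.rank = Module.finrank K Rg := rfl
  omega

variable {ι ι' : Type*} [Fintype ι] [Fintype ι'] [DecidableEq ι] [DecidableEq ι']

omit [Fintype ι] [DecidableEq ι] [DecidableEq ι'] in
/-- Predicate form of `rank_add_rank_le_rank_fromBlocks_triu`: if `M` vanishes on (rows outside `P`) × (columns inside `Q`),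
then the ranks of the blocks `P × Q` and `Pᶜ × Qᶜ` add up below `rank M`. [folklore] -/
theorem rank_blocks_le_of_lowerLeft_zero (M : Matrix ι ι' K) (P : ι → Prop) (Q : ι' → Prop)
    [DecidablePred P] [DecidablePred Q] (h0 : ∀ x y, ¬ P x → Q y → M x y = 0) :
    (M.submatrix (Subtype.val : {x // P x} → ι) (Subtype.val : {y // Q y} → ι')).rank +
      (M.submatrix (Subtype.val : {x // ¬ P x} → ι) (Subtype.val : {y // ¬ Q y} → ι')).rank ≤ M.rank := by
  classical
  set A := M.submatrix (Subtype.val : {x // P x} → ι) (Subtype.val : {y // Q y} → ι')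
  set D := M.submatrix (Subtype.val : {x // ¬ P x} → ι) (Subtype.val : {y // ¬ Q y} → ι')
  set B := M.submatrix (Subtype.val : {x // P x} → ι) (Subtype.val : {y // ¬ Q y} → ι')
  have hre : Matrix.reindex (Equiv.sumCompl P).symm (Equiv.sumCompl Q).symm M = Matrix.fromBlocks A B 0 D := by
    ext (i | i) (j | j)
    · simp [Matrix.reindex_apply, A]
    · simp [Matrix.reindex_apply, B]
    · simp [Matrix.reindex_apply, h0 i.1 j.1 i.2 j.2]
    · simp [Matrix.reindex_apply, D]
  have := rank_add_rank_le_rank_fromBlocks_triu A B D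
  rw [← hre, Matrix.rank_reindex] at this
  exact this

/-- Sums over a subtype against an indicator of one value. -/
theorem sum_ite_val_eq (P : ι → Prop) [DecidablePred P] (x : ι) (f : {a // P a} → K) :
    (∑ a : {a // P a}, if x = a.1 then f a else 0) = if hx : P x then f ⟨x, hx⟩ else 0 := by
  classical
  by_cases hx : P x
  · rw [dif_pos hx, Finset.sum_eq_single (⟨x, hx⟩ : {a // P a})]
    · simp
    · intro a _ ha
      rw [if_neg]
      intro h
      exact ha (Subtype.ext h).symm
    · intro h; exact absurd (Finset.mem_univ _) h
  · rw [dif_neg hx]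
    refine Finset.sum_eq_zero fun a _ => ?_
    rw [if_neg]
    intro h
    apply hx
    rw [h]
    exact a.2

/-- Zero-padding does not increase the rank: the matrix agreeing with `X` on the block `P × Q` and vanishing elsewhere has
rank `≤ rank X`. [folklore] -/
theorem rank_pad_le (P : ι → Prop) (Q : ι' → Prop) [DecidablePred P] [DecidablePred Q]
    (X : Matrix {x // P x} {y // Q y} K) :
    (Matrix.of fun x y => if hx : P x then (if hy : Q y then X ⟨x, hx⟩ ⟨y, hy⟩ else 0) else 0).rank ≤ X.rank := by
  classical
  set Pm : Matrix ι {x // P x} K := Matrix.of fun x a => if x = a.1 then (1 : K) else 0 with hPm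
  set Qm : Matrix {y // Q y} ι' K := Matrix.of fun b y => if y = b.1 then (1 : K) else 0 with hQm
  have h1 : (Matrix.of fun x y => if hx : P x then (if hy : Q y then X ⟨x, hx⟩ ⟨y, hy⟩ else 0) else 0)
      = Pm * X * Qm := by
    ext x y
    have step1 : (Pm * X * Qm) x y =
        ∑ b : {y // Q y}, (∑ a : {x // P x}, (if x = a.1 then X a b else 0)) * (if y = b.1 then 1 else 0) := by
      simp only [Matrix.mul_apply, hPm, hQm, Matrix.of_apply, ite_mul, one_mul, zero_mul]
    rw [step1]
    simp_rw [sum_ite_val_eq P x]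
    by_cases hx : P x
    · simp only [dif_pos hx, mul_ite, mul_one, mul_zero, Matrix.of_apply]
      rw [sum_ite_val_eq Q y (fun b => X ⟨x, hx⟩ b)]
    · simp only [dif_neg hx, zero_mul, Finset.sum_const_zero, Matrix.of_apply]
  rw [h1]
  exact (Matrix.rank_mul_le_left _ _).trans (Matrix.rank_mul_le_right _ _)

end Blocks

section Monotone

/-- **The one-sided (monotone) cut lemma, additive form.** If `R` vanishes on every colour pair with `row_j = true` and
`col_j = false` (support on `row ≤ col` componentwise), then some colour-diagonal `R'` has `rank (R − R') ≤ ∑_j t_j`, the sum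
of the coordinate-cut ranks. [folklore] -/
theorem cutLemma_monotone (n : ℕ) : ∀ (ι ι' : Type*) [Fintype ι] [Fintype ι'] [DecidableEq ι] [DecidableEq ι']
    (row : ι → Fin n → Bool) (col : ι' → Fin n → Bool) (R : Matrix ι ι' K),
    (∀ x y j, row x j = true → col y j = false → R x y = 0) →
      ∃ R' : Matrix ι ι' K, (∀ x y, row x ≠ col y → R' x y = 0) ∧
        (R - R').rank ≤ ∑ j, (Matrix.of fun x y => if row x j ≠ col y j then R x y else 0).rank := by
  induction n with
  | zero =>
      intro ι ι' _ _ _ _ row col R _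
      refine ⟨R, fun x y hne => absurd (funext fun j => Fin.elim0 j) hne, ?_⟩
      simp
  | succ n ih =>
      intro ι ι' _ _ _ _ row col R hmono
      classical
      -- the two halves by the colour bit 0
      let row₀ : {x // row x 0 = false} → Fin n → Bool := fun x j => row x.1 j.succ
      let row₁ : {x // ¬ row x 0 = false} → Fin n → Bool := fun x j => row x.1 j.succ
      let col₀ : {y // col y 0 = false} → Fin n → Bool := fun y j => col y.1 j.succ
      let col₁ : {y // ¬ col y 0 = false} → Fin n → Bool := fun y j => col y.1 j.succ
      let R₀ : Matrix {x // row x 0 = false} {y // col y 0 = false} K := R.submatrix Subtype.val Subtype.val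
      let R₁ : Matrix {x // ¬ row x 0 = false} {y // ¬ col y 0 = false} K := R.submatrix Subtype.val Subtype.val
      have hm₀ : ∀ x y j, row₀ x j = true → col₀ y j = false → R₀ x y = 0 :=
        fun x y j h1 h2 => hmono x.1 y.1 j.succ h1 h2
      have hm₁ : ∀ x y j, row₁ x j = true → col₁ y j = false → R₁ x y = 0 :=
        fun x y j h1 h2 => hmono x.1 y.1 j.succ h1 h2
      obtain ⟨R'₀, hR'₀, hrk₀⟩ := ih _ _ row₀ col₀ R₀ hm₀
      obtain ⟨R'₁, hR'₁, hrk₁⟩ := ih _ _ row₁ col₁ R₁ hm₁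
      -- glue the two colour-diagonal corrections
      let R' : Matrix ι ι' K := Matrix.of fun x y =>
        if hx : row x 0 = false then (if hy : col y 0 = false then R'₀ ⟨x, hx⟩ ⟨y, hy⟩ else 0)
        else (if hy : col y 0 = false then 0 else R'₁ ⟨x, hx⟩ ⟨y, hy⟩)
      have htail : ∀ (x : ι) (y : ι'), row x 0 = col y 0 →
          (fun j : Fin n => row x j.succ) = (fun j => col y j.succ) → row x = col y := by
        intro x y h0 ht
        funext j
        exact Fin.cases h0 (fun j => congrFun ht j) j
      refine ⟨R', fun x y hne => ?_, ?_⟩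
      · -- colour-diagonal support
        simp only [R', Matrix.of_apply]
        by_cases hx : row x 0 = false <;> by_cases hy : col y 0 = false
        · rw [dif_pos hx, dif_pos hy]
          exact hR'₀ ⟨x, hx⟩ ⟨y, hy⟩ fun h => hne (htail x y (by rw [hx, hy]) h)
        · rw [dif_pos hx, dif_neg hy]
        · rw [dif_neg hx, dif_pos hy]
        · rw [dif_neg hx, dif_neg hy]
          have hx' : row x 0 = true := by simpa using hx
          have hy' : col y 0 = true := by simpa using hy
          exact hR'₁ ⟨x, hx⟩ ⟨y, hy⟩ fun h => hne (htail x y (by rw [hx', hy']) h)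
      · -- rank bookkeeping: R - R' = pad(R₀ - R'₀) + pad(R₁ - R'₁) + cut₀(R)
        let E₀ : Matrix ι ι' K := Matrix.of fun x y =>
          if hx : row x 0 = false then (if hy : col y 0 = false then (R₀ - R'₀) ⟨x, hx⟩ ⟨y, hy⟩ else 0) else 0
        let E₁ : Matrix ι ι' K := Matrix.of fun x y =>
          if hx : ¬ row x 0 = false then (if hy : ¬ col y 0 = false then (R₁ - R'₁) ⟨x, hx⟩ ⟨y, hy⟩ else 0) else 0
        let C₀ : Matrix ι ι' K := Matrix.of fun x y => if row x 0 ≠ col y 0 then R x y else 0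
        have hdec : R - R' = E₀ + E₁ + C₀ := by
          ext x y
          simp only [Matrix.sub_apply, Matrix.add_apply, E₀, E₁, C₀, R', Matrix.of_apply, R₀, R₁,
            Matrix.submatrix_apply]
          by_cases hx : row x 0 = false <;> by_cases hy : col y 0 = false
          · rw [dif_pos hx, dif_pos hy, dif_pos hx, dif_pos hy, dif_neg (not_not.mpr hx), if_neg (by rw [hx, hy]; simp)]
            simp
          · have hy' : col y 0 = true := by simpa using hy
            rw [dif_pos hx, dif_neg hy, dif_pos hx, dif_neg hy, dif_neg (not_not.mpr hx), if_pos (by rw [hx, hy']; simp)]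
            simp
          · have hx' : row x 0 = true := by simpa using hx
            have hz : R x y = 0 := hmono x y 0 hx' hy
            rw [dif_neg hx, dif_pos hy, dif_neg hx, dif_pos hx, dif_neg (not_not.mpr hy), hz]
            simp
          · have hx' : row x 0 = true := by simpa using hx
            have hy' : col y 0 = true := by simpa using hy
            rw [dif_neg hx, dif_neg hy, dif_neg hx, dif_pos hx, dif_pos hy, if_neg (by rw [hx', hy']; simp)]
            simp
        have hr₀ : E₀.rank ≤ (R₀ - R'₀).rank := rank_pad_le (fun x => row x 0 = false) (fun y => col y 0 = false) (R₀ - R'₀)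
        have hr₁ : E₁.rank ≤ (R₁ - R'₁).rank :=
          rank_pad_le (fun x => ¬ row x 0 = false) (fun y => ¬ col y 0 = false) (R₁ - R'₁)
        -- cut ranks of the halves add up below the cut ranks of `R`
        have hcut : ∀ j : Fin n,
            (Matrix.of fun (x : {x // row x 0 = false}) (y : {y // col y 0 = false}) =>
                if row₀ x j ≠ col₀ y j then R₀ x y else 0).rank +
              (Matrix.of fun (x : {x // ¬ row x 0 = false}) (y : {y // ¬ col y 0 = false}) =>
                if row₁ x j ≠ col₁ y j then R₁ x y else 0).rank ≤
              (Matrix.of fun x y => if row x j.succ ≠ col y j.succ then R x y else 0).rank := by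
          intro j
          exact rank_blocks_le_of_lowerLeft_zero
            (Matrix.of fun x y => if row x j.succ ≠ col y j.succ then R x y else 0)
            (fun x => row x 0 = false) (fun y => col y 0 = false) (fun x y hx hy => by
              have hx' : row x 0 = true := by simpa using hx
              simp only [Matrix.of_apply]
              split_ifs
              · exact hmono x y 0 hx' hy
              · rfl)
        have hsum :
            (∑ j : Fin n, (Matrix.of fun (x : {x // row x 0 = false}) (y : {y // col y 0 = false}) =>
                if row₀ x j ≠ col₀ y j then R₀ x y else 0).rank) +
            (∑ j : Fin n, (Matrix.of fun (x : {x // ¬ row x 0 = false}) (y : {y // ¬ col y 0 = false}) =>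
                if row₁ x j ≠ col₁ y j then R₁ x y else 0).rank) ≤
            ∑ j : Fin n, (Matrix.of fun x y => if row x j.succ ≠ col y j.succ then R x y else 0).rank := by
          rw [← Finset.sum_add_distrib]
          exact Finset.sum_le_sum fun j _ => hcut j
        rw [hdec, Fin.sum_univ_succ]
        have h3 : (E₀ + E₁ + C₀).rank ≤ E₀.rank + E₁.rank + C₀.rank :=
          (rank_add_le _ _).trans (Nat.add_le_add_right (rank_add_le _ _) _)
        refine h3.trans ?_
        have h4 : E₀.rank + E₁.rank ≤
            ∑ j : Fin n, (Matrix.of fun x y => if row x j.succ ≠ col y j.succ then R x y else 0).rank :=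
          (Nat.add_le_add (hr₀.trans hrk₀) (hr₁.trans hrk₁)).trans hsum
        have h5 : C₀.rank ≤ (Matrix.of fun x y => if row x 0 ≠ col y 0 then R x y else 0).rank := le_rfl
        omega

end Monotone

end Summit.PneNP.PneNP.Theorems.CnfIdealGenLengthRankDefectRepresentationsCutLemmaMonotoneCuts
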